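import Literature.InformationTheory.QuantumCodes.TwoBlockGroupAlgebraCodes
import HarnessLib

/-!
# Lin–Pryadko Theorem 6 for two-block group-algebra codes over an ARBITRARY finite group

[LinPryadko2024, §4.2 Theorem 6]: "For any `a, b ∈ F[G]`, the 2BGA code `LP[a,b]` is equivalent to
(i) `LP[φ(a), φ(b)]` for any automorphism `φ`; (ii) `LP[α⁻¹aα, β⁻¹bβ]` for any `α, β ∈ G`;
(iii) `LP[xa, yb]` for non-zero scalars (vacuous over `𝔽₂`); (iv) `LP[aα, βb]` for any `α, β ∈ G`;
(v) `LP[b̂, â]`; (vi) the code CSS-dual to `LP[a,b]` … is permutation-equivalent to `LP[â, −b̂] ≅ LP[b,a]`."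
Here `â(g) = a(g⁻¹)` is the antipode. The abelian case is `TwoBlockCodeEquivalences.lean`; this file proves
the theorem for the general construction `TwoBlockGA.css a b` (`H_X = [L(a)|R(b)]`, `H_Z = [R(b)ᵀ|L(a)ᵀ]`,
`TwoBlockGroupAlgebraCodes.lean`), each item as an EXPLICIT permutation equivalence (`CSSEquivalence.lean`
"FACT P": qubit bijection + check bijections under which the check matrices are literally submatrices),
so that the qec census cell A.6′ (non-abelian groups, CENSUS-PREREG v1.6 P3.17: classes modulo
"two-sided translations × Aut(G) × swap-with-inversion") quotients by kernel theorems: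

* (i)   `css_mapEquiv_dX/dZ/k`        — `φ : G ≃* G'`, blocks `a ∘ φ⁻¹, b ∘ φ⁻¹`;
* (ii)  `css_conj_dX/dZ/k`            — blocks `g ↦ a(αgα⁻¹)`, `g ↦ b(βgβ⁻¹)` (all indices `z ↦ αzβ⁻¹`);
* (iv)  `css_translate_dX/dZ/k`       — blocks `aα : g ↦ a(gα⁻¹)`, `βb : g ↦ b(β⁻¹g)` (qubits `L_y ↦ L_{αy}`,
        `R_y ↦ R_{yβ}`, `Z`-checks `x ↦ αxβ`); (ii)+(iv) give all TWO-SIDED translations;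
* (v)   `css_hatSwap_dX/dZ/k`         — `LP[b̂, â]`: the SWAP-WITH-INVERSION `L_y ↔ R_{y⁻¹}`, checks `x ↦ x⁻¹`
        (`d^X ↦ d^X`, `d^Z ↦ d^Z`);
* (vi)  `swap_HX/HZ_eq_submatrix_hat`, `css_dZ_eq_dX_hat`, `css_dZ_eq_dX_swapBlocks` — the CSS dual is
        `LP[â, b̂]` with the blocks exchanged, hence **`d^Z(LP[a,b]) = d^X(LP[b,a])`** (the non-abelian
        replacement of `d^X = d^Z`).

All proved; no named facts.

## References (locators read on the page)

* [LinPryadko2024] H.-K. Lin, L. P. Pryadko, PRA 109 (2024) 022407 = arXiv:2306.16400: §4.2 Thm 6 (held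
  text chunk p0009 L66–98) and App. proof (chunk p0018 L3–50: (i) permutation `S`; (ii) `S = L(α⁻¹)R(β)`;
  (iv) `A' = AL, B' = BR`, "u → Lᵀu, v → Rᵀv … H_Z' c_X' = RᵀLᵀ(Bᵀ, −Aᵀ)(u;v) = 0"; (v) "the symmetric
  permutation matrix S = P … interchange the blocks"; (vi) "after a permutation of the blocks, an immediate
  consequence of" `L(a)ᵀ = L(â)`, `R(b)ᵀ = R(b̂)`).
-/

namespace Literature.InformationTheory.QuantumCodes

open Matrix

namespace TwoBlockGA

variable {G : Type*} [Group G] [Fintype G]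

/-! ### The operations on group-algebra elements (as coefficient functions `G → 𝔽₂`) -/

/-- The antipode `â(g) = a(g⁻¹)` (`L(a)ᵀ = L(â)`, `R(b)ᵀ = R(b̂)`).
[cite: LinPryadko2024, §4.1 eq. (12) (arXiv:2306.16400 chunk p0009 L41–45)] -/
def hat (a : G → ZMod 2) : G → ZMod 2 := fun g => a g⁻¹

/-- Right translate `aα`: coefficient `g ↦ a(gα⁻¹)`. [cite: LinPryadko2024, §4.2 Thm 6(iv) (arXiv:2306.16400 chunk p0009 L84)] -/
def rTranslate (α : G) (a : G → ZMod 2) : G → ZMod 2 := fun g => a (g * α⁻¹)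

/-- Left translate `βb`: coefficient `g ↦ b(β⁻¹g)`. [cite: LinPryadko2024, §4.2 Thm 6(iv) (arXiv:2306.16400 chunk p0009 L84)] -/
def lTranslate (β : G) (b : G → ZMod 2) : G → ZMod 2 := fun g => b (β⁻¹ * g)

/-- Conjugate `α⁻¹aα`: coefficient `g ↦ a(αgα⁻¹)`. [cite: LinPryadko2024, §4.2 Thm 6(ii) (arXiv:2306.16400 chunk p0009 L80)] -/
def conj (α : G) (a : G → ZMod 2) : G → ZMod 2 := fun g => a (α * g * α⁻¹)

omit [Fintype G] in
/-- `hat a g = a g⁻¹`. [cite: LinPryadko2024, §4.1 eq. (12) (arXiv:2306.16400 chunk p0009 L41–45)] -/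
@[simp] theorem hat_apply (a : G → ZMod 2) (g : G) : hat a g = a g⁻¹ := rfl

omit [Fintype G] in
/-- `rTranslate α a g = a (g * α⁻¹)`. [cite: LinPryadko2024, §4.2 Thm 6(iv) (arXiv:2306.16400 chunk p0009 L84)] -/
@[simp] theorem rTranslate_apply (α : G) (a : G → ZMod 2) (g : G) : rTranslate α a g = a (g * α⁻¹) := rfl

omit [Fintype G] in
/-- `lTranslate β b g = b (β⁻¹ * g)`. [cite: LinPryadko2024, §4.2 Thm 6(iv) (arXiv:2306.16400 chunk p0009 L84)] -/
@[simp] theorem lTranslate_apply (β : G) (b : G → ZMod 2) (g : G) : lTranslate β b g = b (β⁻¹ * g) := rfl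

omit [Fintype G] in
/-- `conj α a g = a (α * g * α⁻¹)`. [cite: LinPryadko2024, §4.2 Thm 6(ii) (arXiv:2306.16400 chunk p0009 L80)] -/
@[simp] theorem conj_apply (α : G) (a : G → ZMod 2) (g : G) : conj α a g = a (α * g * α⁻¹) := rfl

/-! ### (i) Group isomorphisms `φ : G ≃* G'` -/

section MapEquiv

variable {G' : Type*} [Group G'] [Fintype G']

omit [Fintype G] [Fintype G'] in
/-- `H_X(a∘φ⁻¹, b∘φ⁻¹) = H_X(a,b)` re-indexed by `φ⁻¹` on checks and on both blocks.
[cite: LinPryadko2024, §4.2 Thm 6(i) and App. proof (arXiv:2306.16400 chunk p0009 L76–78, p0018 L3–14)] -/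
theorem HX_mapEquiv (a b : G → ZMod 2) (φ : G ≃* G') :
    HX (a ∘ φ.symm) (b ∘ φ.symm) = (HX a b).submatrix φ.symm.toEquiv (Equiv.sumCongr φ.symm.toEquiv φ.symm.toEquiv) := by
  ext x (y | y) <;> simp

omit [Fintype G] [Fintype G'] in
/-- `H_Z(a∘φ⁻¹, b∘φ⁻¹)` likewise. [cite: LinPryadko2024, §4.2 Thm 6(i) (arXiv:2306.16400 chunk p0009 L76–78)] -/
theorem HZ_mapEquiv (a b : G → ZMod 2) (φ : G ≃* G') :
    HZ (a ∘ φ.symm) (b ∘ φ.symm) = (HZ a b).submatrix φ.symm.toEquiv (Equiv.sumCongr φ.symm.toEquiv φ.symm.toEquiv) := by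
  ext x (y | y) <;> simp

/-- **(i) `d^X`, `d^Z`, `k` are invariant under group isomorphisms applied to both blocks.**
[cite: LinPryadko2024, §4.2 Thm 6(i) (arXiv:2306.16400 chunk p0009 L76–78)] -/
theorem css_mapEquiv_params (a b : G → ZMod 2) (φ : G ≃* G') :
    (css (a ∘ φ.symm) (b ∘ φ.symm)).dX = (css a b).dX ∧ (css (a ∘ φ.symm) (b ∘ φ.symm)).dZ = (css a b).dZ ∧
      (css (a ∘ φ.symm) (b ∘ φ.symm)).k = (css a b).k :=
  ⟨CSSCode.dX_eq_of_submatrix (C := css a b) (C' := css (a ∘ φ.symm) (b ∘ φ.symm)) (HX_mapEquiv a b φ) (HZ_mapEquiv a b φ),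
   CSSCode.dZ_eq_of_submatrix (C := css a b) (C' := css (a ∘ φ.symm) (b ∘ φ.symm)) (HX_mapEquiv a b φ) (HZ_mapEquiv a b φ),
   CSSCode.k_eq_of_submatrix (C := css a b) (C' := css (a ∘ φ.symm) (b ∘ φ.symm)) (HX_mapEquiv a b φ) (HZ_mapEquiv a b φ)⟩

end MapEquiv

/-! ### (ii) Conjugation `LP[α⁻¹aα, β⁻¹bβ]` -/

/-- The index map `z ↦ α z β⁻¹` (used on checks and on both qubit blocks for (ii); LP's `S = L(α⁻¹)R(β)`).
[cite: LinPryadko2024, App. proof of Thm 6(ii) "S = L(α⁻¹)R(β)" (arXiv:2306.16400 chunk p0018 L16–18)] -/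
def conjIndex (α β : G) : G ≃ G := (Equiv.mulLeft α).trans (Equiv.mulRight β⁻¹)

omit [Fintype G] in
/-- `conjIndex α β z = α * z * β⁻¹`. [cite: LinPryadko2024, App. proof of Thm 6(ii) (arXiv:2306.16400 chunk p0018 L16–18)] -/
@[simp] theorem conjIndex_apply (α β z : G) : conjIndex α β z = α * z * β⁻¹ := rfl

omit [Fintype G] in
/-- `H_X(α⁻¹aα, β⁻¹bβ)` is `H_X(a,b)` re-indexed by `z ↦ αzβ⁻¹` everywhere.
[cite: LinPryadko2024, §4.2 Thm 6(ii) (arXiv:2306.16400 chunk p0009 L80)] -/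
theorem HX_conj (a b : G → ZMod 2) (α β : G) :
    HX (conj α a) (conj β b) = (HX a b).submatrix (conjIndex α β) (Equiv.sumCongr (conjIndex α β) (conjIndex α β)) := by
  ext x (y | y)
  · simp only [HX_apply_inl, conj_apply, submatrix_apply, Equiv.sumCongr_apply, Sum.map_inl, conjIndex_apply]
    congr 1; group
  · simp only [HX_apply_inr, conj_apply, submatrix_apply, Equiv.sumCongr_apply, Sum.map_inr, conjIndex_apply]
    congr 1; group

omit [Fintype G] in
/-- `H_Z(α⁻¹aα, β⁻¹bβ)` likewise. [cite: LinPryadko2024, §4.2 Thm 6(ii) (arXiv:2306.16400 chunk p0009 L80)] -/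
theorem HZ_conj (a b : G → ZMod 2) (α β : G) :
    HZ (conj α a) (conj β b) = (HZ a b).submatrix (conjIndex α β) (Equiv.sumCongr (conjIndex α β) (conjIndex α β)) := by
  ext x (y | y)
  · simp only [HZ_apply_inl, conj_apply, submatrix_apply, Equiv.sumCongr_apply, Sum.map_inl, conjIndex_apply]
    congr 1; group
  · simp only [HZ_apply_inr, conj_apply, submatrix_apply, Equiv.sumCongr_apply, Sum.map_inr, conjIndex_apply]
    congr 1; group

/-- **(ii) conjugating the blocks by (independent) group elements preserves `d^X`, `d^Z`, `k`.**
[cite: LinPryadko2024, §4.2 Thm 6(ii) (arXiv:2306.16400 chunk p0009 L80)] -/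
theorem css_conj_params (a b : G → ZMod 2) (α β : G) :
    (css (conj α a) (conj β b)).dX = (css a b).dX ∧ (css (conj α a) (conj β b)).dZ = (css a b).dZ ∧
      (css (conj α a) (conj β b)).k = (css a b).k :=
  ⟨CSSCode.dX_eq_of_submatrix (C := css a b) (C' := css (conj α a) (conj β b)) (HX_conj a b α β) (HZ_conj a b α β),
   CSSCode.dZ_eq_of_submatrix (C := css a b) (C' := css (conj α a) (conj β b)) (HX_conj a b α β) (HZ_conj a b α β),
   CSSCode.k_eq_of_submatrix (C := css a b) (C' := css (conj α a) (conj β b)) (HX_conj a b α β) (HZ_conj a b α β)⟩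

/-! ### (iv) One-sided translations `LP[aα, βb]` -/

/-- The qubit permutation of (iv): `L_y ↦ L_{αy}`, `R_y ↦ R_{yβ}` ("u → Lᵀu, v → Rᵀv").
[cite: LinPryadko2024, App. proof of Thm 6(iv) (arXiv:2306.16400 chunk p0018 L26–32)] -/
def translatePerm (α β : G) : G ⊕ G ≃ G ⊕ G := Equiv.sumCongr (Equiv.mulLeft α) (Equiv.mulRight β)

/-- The `Z`-check permutation of (iv): `x ↦ α x β`. [cite: LinPryadko2024, App. proof of Thm 6(iv) "H_Z' c_X' = RᵀLᵀ(…) = 0" (arXiv:2306.16400 chunk p0018 L33–38)] -/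
def translateZIndex (α β : G) : G ≃ G := (Equiv.mulLeft α).trans (Equiv.mulRight β)

omit [Fintype G] in
/-- `H_X(aα, βb)` is `H_X(a,b)` with the qubits permuted by `translatePerm` (checks fixed): `A' = AL`,
`B' = BR`. [cite: LinPryadko2024, App. proof of Thm 6(iv) "A' = AL, B' = BR" (arXiv:2306.16400 chunk p0018 L26–30)] -/
theorem HX_translate (a b : G → ZMod 2) (α β : G) :
    HX (rTranslate α a) (lTranslate β b) = (HX a b).submatrix (Equiv.refl G) (translatePerm α β) := by
  ext x (y | y)
  · simp only [HX_apply_inl, rTranslate_apply, submatrix_apply, Equiv.coe_refl, id_eq, translatePerm,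
      Equiv.sumCongr_apply, Sum.map_inl, Equiv.coe_mulLeft]
    congr 1; group
  · simp only [HX_apply_inr, lTranslate_apply, submatrix_apply, Equiv.coe_refl, id_eq, translatePerm,
      Equiv.sumCongr_apply, Sum.map_inr, Equiv.coe_mulRight]
    congr 1; group

omit [Fintype G] in
/-- `H_Z(aα, βb)` is `H_Z(a,b)` with the qubits permuted by `translatePerm` and the checks by `x ↦ αxβ`.
[cite: LinPryadko2024, App. proof of Thm 6(iv) (arXiv:2306.16400 chunk p0018 L26–38)] -/
theorem HZ_translate (a b : G → ZMod 2) (α β : G) :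
    HZ (rTranslate α a) (lTranslate β b) = (HZ a b).submatrix (translateZIndex α β) (translatePerm α β) := by
  ext x (y | y)
  · simp only [HZ_apply_inl, lTranslate_apply, submatrix_apply, translateZIndex, Equiv.trans_apply,
      Equiv.coe_mulLeft, Equiv.coe_mulRight, translatePerm, Equiv.sumCongr_apply, Sum.map_inl]
    congr 1; group
  · simp only [HZ_apply_inr, rTranslate_apply, submatrix_apply, translateZIndex, Equiv.trans_apply,
      Equiv.coe_mulLeft, Equiv.coe_mulRight, translatePerm, Equiv.sumCongr_apply, Sum.map_inr]
    congr 1; group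

/-- **(iv) translating `a` on the right and `b` on the left (independently) preserves `d^X`, `d^Z`, `k`**;
with (ii) this covers every two-sided translation `a ↦ uav`, `b ↦ u'bv'`.
[cite: LinPryadko2024, §4.2 Thm 6(iv) (arXiv:2306.16400 chunk p0009 L84)] -/
theorem css_translate_params (a b : G → ZMod 2) (α β : G) :
    (css (rTranslate α a) (lTranslate β b)).dX = (css a b).dX ∧
      (css (rTranslate α a) (lTranslate β b)).dZ = (css a b).dZ ∧
      (css (rTranslate α a) (lTranslate β b)).k = (css a b).k :=
  ⟨CSSCode.dX_eq_of_submatrix (C := css a b) (C' := css (rTranslate α a) (lTranslate β b)) (HX_translate a b α β)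
      (HZ_translate a b α β),
   CSSCode.dZ_eq_of_submatrix (C := css a b) (C' := css (rTranslate α a) (lTranslate β b)) (HX_translate a b α β)
      (HZ_translate a b α β),
   CSSCode.k_eq_of_submatrix (C := css a b) (C' := css (rTranslate α a) (lTranslate β b)) (HX_translate a b α β)
      (HZ_translate a b α β)⟩

/-! ### (v) `LP[b̂, â]`: swap-with-inversion -/

/-- The qubit permutation of (v): `L_y ↔ R_{y⁻¹}` ("the symmetric permutation matrix S = P … and, in addition,
interchange the blocks"). [cite: LinPryadko2024, App. proof of Thm 6(v) (arXiv:2306.16400 chunk p0018 L40–43)] -/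
def hatSwapPerm (G : Type*) [Group G] : G ⊕ G ≃ G ⊕ G :=
  (Equiv.sumComm G G).trans (Equiv.sumCongr (Equiv.inv G) (Equiv.inv G))

omit [Fintype G] in
/-- `hatSwapPerm (L y) = R y⁻¹`. [cite: LinPryadko2024, App. proof of Thm 6(v) (arXiv:2306.16400 chunk p0018 L40–43)] -/
@[simp] theorem hatSwapPerm_inl (y : G) : hatSwapPerm G (Sum.inl y) = Sum.inr y⁻¹ := rfl

omit [Fintype G] in
/-- `hatSwapPerm (R y) = L y⁻¹`. [cite: LinPryadko2024, App. proof of Thm 6(v) (arXiv:2306.16400 chunk p0018 L40–43)] -/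
@[simp] theorem hatSwapPerm_inr (y : G) : hatSwapPerm G (Sum.inr y) = Sum.inl y⁻¹ := rfl

omit [Fintype G] in
/-- `H_X(b̂, â)` is `H_X(a,b)` with checks `x ↦ x⁻¹` and qubits `L_y ↔ R_{y⁻¹}`.
[cite: LinPryadko2024, §4.2 Thm 6(v) (arXiv:2306.16400 chunk p0009 L86)] -/
theorem HX_hatSwap (a b : G → ZMod 2) :
    HX (hat b) (hat a) = (HX a b).submatrix (Equiv.inv G) (hatSwapPerm G) := by
  ext x (y | y)
  · simp only [HX_apply_inl, hat_apply, submatrix_apply, Equiv.inv_apply, hatSwapPerm_inl, HX_apply_inr]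
    congr 1; group
  · simp only [HX_apply_inr, hat_apply, submatrix_apply, Equiv.inv_apply, hatSwapPerm_inr, HX_apply_inl]
    congr 1; group

omit [Fintype G] in
/-- `H_Z(b̂, â)` likewise. [cite: LinPryadko2024, §4.2 Thm 6(v) (arXiv:2306.16400 chunk p0009 L86)] -/
theorem HZ_hatSwap (a b : G → ZMod 2) :
    HZ (hat b) (hat a) = (HZ a b).submatrix (Equiv.inv G) (hatSwapPerm G) := by
  ext x (y | y)
  · simp only [HZ_apply_inl, hat_apply, submatrix_apply, Equiv.inv_apply, hatSwapPerm_inl, HZ_apply_inr]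
    congr 1; group
  · simp only [HZ_apply_inr, hat_apply, submatrix_apply, Equiv.inv_apply, hatSwapPerm_inr, HZ_apply_inl]
    congr 1; group

/-- **(v) `LP[b̂, â]` has the `d^X`, `d^Z`, `k` of `LP[a,b]`** (types preserved: `d^X ↦ d^X`).
[cite: LinPryadko2024, §4.2 Thm 6(v) (arXiv:2306.16400 chunk p0009 L86)] -/
theorem css_hatSwap_params (a b : G → ZMod 2) :
    (css (hat b) (hat a)).dX = (css a b).dX ∧ (css (hat b) (hat a)).dZ = (css a b).dZ ∧
      (css (hat b) (hat a)).k = (css a b).k :=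
  ⟨CSSCode.dX_eq_of_submatrix (C := css a b) (C' := css (hat b) (hat a)) (HX_hatSwap a b) (HZ_hatSwap a b),
   CSSCode.dZ_eq_of_submatrix (C := css a b) (C' := css (hat b) (hat a)) (HX_hatSwap a b) (HZ_hatSwap a b),
   CSSCode.k_eq_of_submatrix (C := css a b) (C' := css (hat b) (hat a)) (HX_hatSwap a b) (HZ_hatSwap a b)⟩

/-! ### (vi) The CSS dual: `d^Z(LP[a,b]) = d^X(LP[b,a])` -/

/-- The `X ↔ Z` exchange of `LP[a,b]` has `H_X = H_Z(a,b) = [R(b̂) | L(â)]`, i.e. `H_X(â, b̂)` with the two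
blocks exchanged ("after a permutation of the blocks, an immediate consequence of" `L(a)ᵀ = L(â)`,
`R(b)ᵀ = R(b̂)`). [cite: LinPryadko2024, §4.2 Thm 6(vi) and App. proof (arXiv:2306.16400 chunk p0009 L88–91, p0018 L44–46)] -/
theorem swap_HX_eq_submatrix_hat (a b : G → ZMod 2) :
    (css a b).swap.HX = (css (hat a) (hat b)).HX.submatrix (Equiv.refl G) (Equiv.sumComm G G) := by
  ext x (y | y) <;> simp [CSSCode.swap]

/-- … and `H_Z = H_X(a,b) = H_Z(â, b̂)` with the blocks exchanged. [cite: LinPryadko2024, §4.2 Thm 6(vi) (arXiv:2306.16400 chunk p0009 L88–91)] -/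
theorem swap_HZ_eq_submatrix_hat (a b : G → ZMod 2) :
    (css a b).swap.HZ = (css (hat a) (hat b)).HZ.submatrix (Equiv.refl G) (Equiv.sumComm G G) := by
  ext x (y | y) <;> simp [CSSCode.swap]

/-- **(vi) `d^Z(LP[a,b]) = d^X(LP[â,b̂])`**, `d^X(LP[a,b]) = d^Z(LP[â,b̂])`, `k` equal.
[cite: LinPryadko2024, §4.2 Thm 6(vi) (arXiv:2306.16400 chunk p0009 L88–91)] -/
theorem css_dual_params (a b : G → ZMod 2) :
    (css a b).dZ = (css (hat a) (hat b)).dX ∧ (css a b).dX = (css (hat a) (hat b)).dZ ∧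
      (css a b).k = (css (hat a) (hat b)).k := by
  refine ⟨?_, ?_, ?_⟩
  · rw [← CSSCode.dX_swap]
    exact CSSCode.dX_eq_of_submatrix (C := css (hat a) (hat b)) (C' := (css a b).swap)
      (swap_HX_eq_submatrix_hat a b) (swap_HZ_eq_submatrix_hat a b)
  · rw [← CSSCode.dZ_swap]
    exact CSSCode.dZ_eq_of_submatrix (C := css (hat a) (hat b)) (C' := (css a b).swap)
      (swap_HX_eq_submatrix_hat a b) (swap_HZ_eq_submatrix_hat a b)
  · rw [← CSSCode.k_swap]
    exact CSSCode.k_eq_of_submatrix (C := css (hat a) (hat b)) (C' := (css a b).swap)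
      (swap_HX_eq_submatrix_hat a b) (swap_HZ_eq_submatrix_hat a b)

omit [Fintype G] in
/-- `hat` is an involution. [cite: LinPryadko2024, §4.1 eq. (12) (arXiv:2306.16400 chunk p0009 L41–45)] -/
@[simp] theorem hat_hat (a : G → ZMod 2) : hat (hat a) = a := by
  funext g; simp

/-- **`d^Z(LP[a,b]) = d^X(LP[b,a])`** for every finite group — the non-abelian form of the abelian
`d^X = d^Z` ((vi) then (v) applied to `(â, b̂)`: `LP[â,b̂] ≅ LP[b,a]` with types preserved).
[cite: LinPryadko2024, §4.2 Thm 6(vi) "LP[â, −b̂] ≅ LP[b,a]" (arXiv:2306.16400 chunk p0009 L88–91)] -/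
theorem css_dZ_eq_dX_swapBlocks (a b : G → ZMod 2) : (css a b).dZ = (css b a).dX := by
  rw [(css_dual_params a b).1]
  have h := (css_hatSwap_params (hat a) (hat b)).1
  rw [hat_hat, hat_hat] at h
  exact h.symm

/-- Dually `d^X(LP[a,b]) = d^Z(LP[b,a])`. [cite: LinPryadko2024, §4.2 Thm 6(vi) (arXiv:2306.16400 chunk p0009 L88–91)] -/
theorem css_dX_eq_dZ_swapBlocks (a b : G → ZMod 2) : (css a b).dX = (css b a).dZ :=
  (css_dZ_eq_dX_swapBlocks b a).symm

/-- And `k(LP[a,b]) = k(LP[b,a])`. [cite: LinPryadko2024, §4.2 Thm 6(vi) (arXiv:2306.16400 chunk p0009 L88–91)] -/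
theorem css_k_eq_k_swapBlocks (a b : G → ZMod 2) : (css a b).k = (css b a).k := by
  rw [(css_dual_params a b).2.2]
  have h := (css_hatSwap_params (hat a) (hat b)).2.2
  rw [hat_hat, hat_hat] at h
  exact h.symm

end TwoBlockGA

end Literature.InformationTheory.QuantumCodes
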